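import Summits.AtomisticToContinuum.HydrodynamicLimit.Theorems.OneFlightGossipEngineEnergyCurrentTailsGainCeilingGlue
import Literature.Analysis.FluidPDE.EmpiricalCollisionMeasureMeasurableLabels
import Literature.Analysis.FluidPDE.HardSphereCollisionRecord
import Literature.MathematicalPhysics.KineticTheory.HardSphereEulerProofs
import HarnessLib

/-!
# The loss-intensity floor LIF′ from rate floor, split deficit and flux ceiling (stub
# `stub_lossIntensityFloor_of_rateSplitFlux`, line `quartic-schur-ledger`, crux `EnergyCurrentTails`,
# stmt-AtomisticToContinuum-9235)

Registered glue stub `RF₂ → SD → S2a″ → LIF` of the lead's skeleton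
`Cruxes/EnergyCurrentTails/Lines/quartic_schur_ledger.lean`.  Per ORDERED collision record
(`pre = ‖v₁⁻‖⁴+‖v₂⁻‖⁴`, `post = ‖v₁⁺‖⁴+‖v₂⁺‖⁴`, `mix± = ‖v₁±‖²‖v₂±‖²`; pair energy conservation
`HardSphereCollisionRecord.ofConfig_norm_sq_preVel` gives `E² = pre + 2mix⁻ = post + 2mix⁺`):
`𝟙‖v₁⁻‖⁴ ≤ E²` and `2mix⁺ = (pre − post) + 2mix⁻ ≤ 2(pre−post)₊/2 + 2mix⁻`.  The routes' `∑ᶠ` forms of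
RF₂ and SD are `ofReal` of the line's real collision sums on the conull good set (bridge
`c5lif_ofReal_collisionSum_eq_finsum` + `ofConfig_preVel_eq_collidePair` / `ofConfig_postVel`), so
in `ℝ≥0∞`: `δ·cν∫M₅^{>max K₀ 1} ≤ δ·cν∫M₅^{>K₀} ≤ δ·E[Σ𝟙(N+1)⁻¹‖v₁⁻‖⁴] ≤ δ·E[Σ(N+1)⁻¹E²]
≤ E[Σ(N+1)⁻¹2mix⁺] ≤ 2Loss + 2E[(N+1)⁻¹Σmix⁻] ≤ 2Loss + 2Cν(s′−s) sup m₂ sup m₃`; the one splitting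
of an integral of a sum uses the a.e.-measurability of the flux integrand (`‖v₁⁻‖²‖v₂⁻‖²` is a
continuous function of the collision mark, `HardSphereFlow.aemeasurable_of_eqOn_collisionSum_labels_torus`).
Constants: `σ₀ = min(σ₁,σ₂,σ₃,1/2)`, `δ_LIF = δc/2`, `K₀ ↦ max K₀ 1`, `C_LIF = C`, `N₀ = max N₁ N₂ N₃`.
References: Bobylev 1997; Mischler–Wennberg 1999 (Povzner with exact energy-split variables);
Cercignani–Illner–Pulvirenti 1994 §4.2, App. 4.A.
-/

noncomputable section

open MeasureTheory Set Filter
open scoped ENNReal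

namespace Summit.AtomisticToContinuum.HydrodynamicLimit.Theorems.QuarticSchurLedger

open Literature.MathematicalPhysics.KineticTheory Literature.Analysis.FluidPDE

/-- The cut-off quartic pre-mark is at most the squared pair energy: `𝟙{K₀ < y₁}·c·y₁⁴ ≤ c·(x₁²+x₂²)²`
(`c ≥ 0`, pair energy conserved `y₁² + y₂² = x₁² + x₂²`). [folklore] -/
theorem c5lif_cutoff_le_sqE {x₁ x₂ y₁ y₂ c K₀ : ℝ} (hc : 0 ≤ c)
    (h : y₁ ^ 2 + y₂ ^ 2 = x₁ ^ 2 + x₂ ^ 2) :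
    (if K₀ < y₁ then c * y₁ ^ 4 else 0) ≤ c * (x₁ ^ 2 + x₂ ^ 2) ^ 2 := by
  have h1 : (x₁ ^ 2 + x₂ ^ 2) ^ 2 = y₁ ^ 4 + y₂ ^ 2 * (2 * y₁ ^ 2 + y₂ ^ 2) := by rw [← h]; ring
  have h2 : 0 ≤ y₂ ^ 2 * (2 * y₁ ^ 2 + y₂ ^ 2) := by positivity
  have h4 : c * y₁ ^ 4 ≤ c * (x₁ ^ 2 + x₂ ^ 2) ^ 2 := mul_le_mul_of_nonneg_left (by linarith) hc
  split_ifs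
  · exact h4
  · positivity

/-- **The signed Povzner identity at `p = 2`, one-sided**: with the pair energy conserved,
`2x₁²x₂² = (y₁⁴+y₂⁴−x₁⁴−x₂⁴) + 2y₁²y₂² ≤ 2·((y₁⁴+y₂⁴−x₁⁴−x₂⁴)₊/2) + 2·y₁²y₂²`, scaled by `c ≥ 0`
(`x` = post-, `y` = pre-collisional speeds). [folklore] -/
theorem c5lif_mixpost_le {x₁ x₂ y₁ y₂ c : ℝ} (hc : 0 ≤ c)
    (h : y₁ ^ 2 + y₂ ^ 2 = x₁ ^ 2 + x₂ ^ 2) :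
    c * (2 * (x₁ ^ 2 * x₂ ^ 2)) ≤
      2 * (c * (max (y₁ ^ 4 + y₂ ^ 4 - x₁ ^ 4 - x₂ ^ 4) 0 / 2)) + 2 * (c * (y₁ ^ 2 * y₂ ^ 2)) := by
  have key : 2 * (x₁ ^ 2 * x₂ ^ 2) =
      (y₁ ^ 4 + y₂ ^ 4 - x₁ ^ 4 - x₂ ^ 4) + 2 * (y₁ ^ 2 * y₂ ^ 2) := by
    linear_combination (x₁ ^ 2 + x₂ ^ 2 + y₁ ^ 2 + y₂ ^ 2) * h.symm
  have hmax := le_max_left (y₁ ^ 4 + y₂ ^ 4 - x₁ ^ 4 - x₂ ^ 4) 0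
  have hle : 2 * (x₁ ^ 2 * x₂ ^ 2) ≤
      2 * (max (y₁ ^ 4 + y₂ ^ 4 - x₁ ^ 4 - x₂ ^ 4) 0 / 2) + 2 * (y₁ ^ 2 * y₂ ^ 2) := by
    rw [key]; linarith
  calc c * (2 * (x₁ ^ 2 * x₂ ^ 2))
      ≤ c * (2 * (max (y₁ ^ 4 + y₂ ^ 4 - x₁ ^ 4 - x₂ ^ 4) 0 / 2) + 2 * (y₁ ^ 2 * y₂ ^ 2)) :=
        mul_le_mul_of_nonneg_left hle hc
    _ = _ := by ring

/-- Raising the cut-off lowers the cut-off fifth power: `𝟙{K₁ < a} a⁵ ≤ 𝟙{K₀ < a} a⁵` for `K₀ ≤ K₁`,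
`a ≥ 0`. [folklore] -/
theorem c5lif_cutoff_mono {K₀ K₁ a : ℝ} (hK : K₀ ≤ K₁) (ha : 0 ≤ a) :
    (if K₁ < a then a ^ 5 else 0) ≤ (if K₀ < a then a ^ 5 else 0) := by
  split_ifs with h1 h2
  · exact le_rfl
  · exact absurd (hK.trans_lt h1) h2
  · positivity
  · exact le_rfl

/-- `ofReal (2a + 2b) = 2·ofReal a + 2·ofReal b` for `a, b ≥ 0`. [folklore] -/
theorem c5lif_ofReal_two_mul_add {a b : ℝ} (ha : 0 ≤ a) (hb : 0 ≤ b) :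
    ENNReal.ofReal (2 * a + 2 * b) = 2 * ENNReal.ofReal a + 2 * ENNReal.ofReal b := by
  rw [ENNReal.ofReal_add (by positivity) (by positivity), ENNReal.ofReal_mul zero_le_two,
    ENNReal.ofReal_mul zero_le_two, ENNReal.ofReal_ofNat 2]

section Pathwise

variable {d X : Type*} [Fintype d] [MeasureSpace X] [TopologicalSpace X] {G : Geometry d X}
  {ε : ℝ} {n : ℕ}

/-- A collision sum of a non-negative functional along the flow is non-negative. [folklore] -/
theorem c5lif_collisionSum_nonneg (Φ : HardSphereFlow G ε n)
    {F : HardSphereCollisionRecord d X n → ℝ} (hF : ∀ c, 0 ≤ F c) (S : Set ℝ) (z : Config n d X) :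
    0 ≤ Φ.collisionSum S F z := by
  rw [HardSphereFlow.collisionSum_eq, collisionSum_eq_collisionPairSum]
  exact collisionPairSum_nonneg fun _ _ _ => hF _

/-- **Route form with labelled marks** (the bridge of seat a1's `leadBridge_ofReal_collisionSum_eq_finsum`, inlined):
on the good set, for `F ≥ 0` and marks `φ i j y` with `ofReal (F (record of (t,i,j) read off y)) =
φ i j y` (`i ≠ j`), `ofReal (Σ_{collisions in (a,b]} F)` is the routes' `∑ᶠ` double sum of the `φ i j`.
[folklore] -/
theorem c5lif_ofReal_collisionSum_eq_finsum (Φ : HardSphereFlow G ε n) {z : Config n d X}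
    (hz : z ∈ Φ.good) (a b : ℝ) (F : HardSphereCollisionRecord d X n → ℝ) (hF : ∀ c, 0 ≤ F c)
    (φ : Fin n → Fin n → Config n d X → ℝ≥0∞)
    (hφ : ∀ (y : Config n d X) (t : ℝ) (i j : Fin n), i ≠ j →
      ENNReal.ofReal (F (HardSphereCollisionRecord.ofConfig G ε y t i j)) = φ i j y) :
    ENNReal.ofReal (Φ.collisionSum (Ioc a b) F z) =
      ∑ᶠ t ∈ collisionTimes G ε (fun r => Φ.flow r z) ∩ Ioc a b, ∑ i : Fin n, ∑ j : Fin n,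
        if i = j then (0 : ℝ≥0∞) else (contactSet G n ε i j).indicator (φ i j) (Φ.flow t z) := by
  -- (bridge inlined, seat c5: the landed `leadBridge_ofReal_collisionSum_eq_finsum` lives in a module
  -- that no longer builds after the route repair of 2026-08-17T00:59Z removed its route hypothesis)
  have hfin := Φ.finite_collisionTimes_inter hz (Ioc_subset_Icc_self (a := a) (b := b))
  rw [HardSphereFlow.collisionSum_eq, collisionSum_eq_collisionPairSum,
    collisionPairSum_eq_finset_sum hfin, finsum_mem_eq_finite_toFinset_sum _ hfin,
    ENNReal.ofReal_sum_of_nonneg fun t _ => Finset.sum_nonneg fun p _ => hF _]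
  refine Finset.sum_congr rfl fun t _ => ?_
  rw [ENNReal.ofReal_sum_of_nonneg fun p _ => hF _]
  have hdom : Φ.flow t z ∈ hardSphereDomain G n ε := (Φ.isTrajectory z hz).mem t
  rw [sum_contactPairs_eq hdom
    (fun i j => ENNReal.ofReal (F (HardSphereCollisionRecord.ofConfig G ε (Φ.flow t z) t i j)))]
  refine Finset.sum_congr rfl fun i _ => Finset.sum_congr rfl fun j _ => ?_
  by_cases hij : i = j
  · simp [hij]
  · by_cases hc : ‖G.sepVec (Φ.flow t z i).1 (Φ.flow t z j).1‖ = ε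
    · have hmem : Φ.flow t z ∈ contactSet G n ε i j := mem_contactSet.2 ⟨hdom, hc⟩
      simp [hij, hc, Set.indicator_of_mem hmem, hφ _ t i j hij]
    · have hnmem : Φ.flow t z ∉ contactSet G n ε i j := fun h => hc (mem_contactSet.1 h).2
      simp [hij, hc, Set.indicator_of_notMem hnmem]

/-- Route form of the cut-off quartic pre-mark sum (the right-hand side of RF₂): the record's
pre-collisional velocities are the `collidePair` velocities (`ofConfig_preVel_eq_collidePair`).
[folklore] -/
theorem c5lif_bridge_cutoff (Φ : HardSphereFlow G ε n) {z : Config n d X} (hz : z ∈ Φ.good)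
    (a b K₀ c : ℝ) (hc : 0 ≤ c) :
    (∑ᶠ t ∈ collisionTimes G ε (fun r => Φ.flow r z) ∩ Ioc a b, ∑ i : Fin n, ∑ j : Fin n,
        if i = j then (0 : ℝ≥0∞) else (contactSet G n ε i j).indicator
          (fun y => if K₀ < ‖((collidePair G i j y) i).2‖ then
            ENNReal.ofReal (c * ‖((collidePair G i j y) i).2‖ ^ 4) else 0) (Φ.flow t z)) =
      ENNReal.ofReal (Φ.collisionSum (Ioc a b)
        (fun col => if K₀ < ‖col.preVel.1‖ then c * ‖col.preVel.1‖ ^ 4 else 0) z) := by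
  symm
  refine c5lif_ofReal_collisionSum_eq_finsum Φ hz a b _ (fun col => ?_) _ fun y t i j hij => ?_
  · split_ifs <;> positivity
  · simp only [HardSphereCollisionRecord.ofConfig_preVel_eq_collidePair G ε y t hij]
    split_ifs <;> simp

/-- Route form of a post-collisional pair-mark sum (both sides of SD; `ofConfig_postVel`). [folklore] -/
theorem c5lif_bridge_post (Φ : HardSphereFlow G ε n) {z : Config n d X} (hz : z ∈ Φ.good)
    (a b : ℝ) (g : EuclideanSpace ℝ d → EuclideanSpace ℝ d → ℝ) (hg : ∀ v w, 0 ≤ g v w) :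
    (∑ᶠ t ∈ collisionTimes G ε (fun r => Φ.flow r z) ∩ Ioc a b, ∑ i : Fin n, ∑ j : Fin n,
        if i = j then (0 : ℝ≥0∞) else (contactSet G n ε i j).indicator
          (fun y => ENNReal.ofReal (g (y i).2 (y j).2)) (Φ.flow t z)) =
      ENNReal.ofReal (Φ.collisionSum (Ioc a b) (fun col => g col.postVel.1 col.postVel.2) z) := by
  symm
  refine c5lif_ofReal_collisionSum_eq_finsum Φ hz a b _ (fun col => hg _ _) _ fun y t i j _ => ?_
  rfl

/-- **Pathwise: the cut-off quartic pre-mark sum is at most the squared-pair-energy sum** (record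
by record `c5lif_cutoff_le_sqE`, `ofConfig_norm_sq_preVel`, `collisionPairSum_mono`). [folklore] -/
theorem c5lif_cutoffSum_le_sqESum (Φ : HardSphereFlow G ε n) {z : Config n d X} (hz : z ∈ Φ.good)
    (a b K₀ : ℝ) {c : ℝ} (hc : 0 ≤ c) :
    Φ.collisionSum (Ioc a b)
        (fun col => if K₀ < ‖col.preVel.1‖ then c * ‖col.preVel.1‖ ^ 4 else 0) z ≤
      Φ.collisionSum (Ioc a b)
        (fun col => c * (‖col.postVel.1‖ ^ 2 + ‖col.postVel.2‖ ^ 2) ^ 2) z := by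
  rw [HardSphereFlow.collisionSum_eq, HardSphereFlow.collisionSum_eq,
    collisionSum_eq_collisionPairSum, collisionSum_eq_collisionPairSum]
  refine collisionPairSum_mono (Φ.finite_collisionTimes_inter hz Ioc_subset_Icc_self) fun t _ p _ => ?_
  exact c5lif_cutoff_le_sqE hc (HardSphereCollisionRecord.ofConfig_norm_sq_preVel G ε (Φ.flow t z) t p.1 p.2)

/-- **Pathwise: the one-sided Povzner identity summed over the window, in `ℝ≥0∞`**:
`ofReal (Σ c·2mix⁺) ≤ 2·ofReal (c Σ (Δ₄)₋/2) + 2·ofReal (c Σ mix⁻)` (record by record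
`c5lif_mixpost_le`; `collisionPairSum_mono/_add/_const_mul`). [folklore] -/
theorem c5lif_ofReal_mixpostSum_le (Φ : HardSphereFlow G ε n) {z : Config n d X} (hz : z ∈ Φ.good)
    (a b : ℝ) {c : ℝ} (hc : 0 ≤ c) :
    ENNReal.ofReal (Φ.collisionSum (Ioc a b)
        (fun col => c * (2 * (‖col.postVel.1‖ ^ 2 * ‖col.postVel.2‖ ^ 2))) z) ≤
      2 * ENNReal.ofReal (c * Φ.collisionSum (Ioc a b)
        (fun col => max (‖col.preVel.1‖ ^ 4 + ‖col.preVel.2‖ ^ 4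
          - ‖col.postVel.1‖ ^ 4 - ‖col.postVel.2‖ ^ 4) 0 / 2) z) +
      2 * ENNReal.ofReal (c * Φ.collisionSum (Ioc a b)
        (fun col => ‖col.preVel.1‖ ^ 2 * ‖col.preVel.2‖ ^ 2) z) := by
  rw [← c5lif_ofReal_two_mul_add
    (mul_nonneg hc (c5lif_collisionSum_nonneg Φ (fun _ => by positivity) _ _))
    (mul_nonneg hc (c5lif_collisionSum_nonneg Φ (fun _ => by positivity) _ _))]
  refine ENNReal.ofReal_le_ofReal ?_
  have hfin := Φ.finite_collisionTimes_inter hz (S := Ioc a b) Ioc_subset_Icc_self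
  simp only [HardSphereFlow.collisionSum_eq, collisionSum_eq_collisionPairSum]
  rw [← collisionPairSum_const_mul hfin c, ← collisionPairSum_const_mul hfin c,
    ← collisionPairSum_const_mul hfin 2, ← collisionPairSum_const_mul hfin 2,
    ← collisionPairSum_add hfin]
  refine collisionPairSum_mono hfin fun t _ p _ => ?_
  exact c5lif_mixpost_le hc (HardSphereCollisionRecord.ofConfig_norm_sq_preVel G ε (Φ.flow t z) t p.1 p.2)

end Pathwise

/-- **The energy-flux collision sum is a.e.-measurable** under any law carried by the good set
(torus, `ε < 1/2`): the mark `‖v₁⁻‖²‖v₂⁻‖²` is a continuous function of the collision mark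
(`HardSphereFlow.aemeasurable_of_eqOn_collisionSum_labels_torus`). [folklore] -/
theorem c5lif_aemeasurable_fluxSum {N : ℕ} {ε : ℝ} (hε : ε < 2⁻¹)
    (Φ : HardSphereFlow (Torus.geometry (Fin 3)) ε (N + 1)) (a b : ℝ)
    {μ : Measure (Config (N + 1) (Fin 3) T3)} (hμ : ∀ᵐ z ∂μ, z ∈ Φ.good) :
    AEMeasurable (fun z => Φ.collisionSum (Ioc a b)
      (fun col => ‖col.preVel.1‖ ^ 2 * ‖col.preVel.2‖ ^ 2) z) μ := by
  have hFc : ∀ _i _j : Fin (N + 1), Continuous fun m : ℝ × T3 × V3 × V3 × V3 =>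
      ‖m.2.2.2.1‖ ^ 2 * ‖m.2.2.2.2‖ ^ 2 := fun _ _ => by fun_prop
  refine Φ.aemeasurable_of_eqOn_collisionSum_labels_torus hε hFc a b (fun z _ => ?_) hμ
  rfl

/-- **The arithmetic of LIF′.**  From `I′ ≤ I`, `ofReal(cν)·I ≤ P ≤ Q`, `ofReal δ · Q ≤ R ≤ 2L + 2X`
and `X ≤ Y`:  `ofReal(δc/2 · ν) · I′ ≤ L + Y` (everything in `ℝ≥0∞`). [folklore] -/
theorem c5lif_assembly {I' I P Q R L X Y : ℝ≥0∞} {δ c ν : ℝ} (hδ : 0 ≤ δ)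
    (h5 : I' ≤ I) (hP : ENNReal.ofReal (c * ν) * I ≤ P) (hPQ : P ≤ Q)
    (hQR : ENNReal.ofReal δ * Q ≤ R) (hR : R ≤ 2 * L + 2 * X) (hXY : X ≤ Y) :
    ENNReal.ofReal (δ * c / 2 * ν) * I' ≤ L + Y := by
  have h2 : (2 : ℝ≥0∞) * (ENNReal.ofReal (δ * c / 2 * ν) * I') ≤ 2 * (L + Y) := by
    calc (2 : ℝ≥0∞) * (ENNReal.ofReal (δ * c / 2 * ν) * I')
        = ENNReal.ofReal δ * (ENNReal.ofReal (c * ν) * I') := by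
          rw [← mul_assoc, ← mul_assoc, ← ENNReal.ofReal_ofNat 2, ← ENNReal.ofReal_mul (by positivity),
            ← ENNReal.ofReal_mul hδ]
          congr 2
          ring
      _ ≤ ENNReal.ofReal δ * (ENNReal.ofReal (c * ν) * I) := by gcongr
      _ ≤ ENNReal.ofReal δ * Q := by gcongr; exact hP.trans hPQ
      _ ≤ 2 * L + 2 * X := hQR.trans hR
      _ ≤ 2 * L + 2 * Y := by gcongr
      _ = 2 * (L + Y) := (mul_add 2 L Y).symm
  exact (ENNReal.mul_le_mul_iff_right two_ne_zero ENNReal.ofNat_ne_top).1 h2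

/-- **Stub LIF′ — THE QUARTIC LOSS-INTENSITY FLOOR FROM RATE FLOOR, SPLIT DEFICIT AND FLUX CEILING**
(registered glue stub of the line `quartic-schur-ledger`, crux stmt-AtomisticToContinuum-9235
`EnergyCurrentTails`): `RF₂ → SD → S2a″ → LIF` — for every horizon `T > 0` and flow family there are
`δ > 0`, `K₀ ≥ 1`, `C ≥ 0`, `N₀` with, for `N ≥ N₀` and `0 ≤ s ≤ s′ ≤ T`,
`δ ν_N ∫_s^{s′} M₅^{>K₀}(r) dr ≤ Loss_N(s,s′] + C ν_N (s′−s) · sup m₂ · sup m₃` (see the module doc-string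
for the proof; `δ_LIF = δ_SD c_RF/2`, `K₀ = max K₀^{RF} 1`, `C = C_{S2a″}`). [folklore] -/
theorem stub_lossIntensityFloor_of_rateSplitFlux :
    (∀ (a₀ θ₀ : T3 → ℝ) (u₀ : T3 → V3), Continuous a₀ → Continuous θ₀ → Continuous u₀ → (∀ x, 0 < a₀
    x) → (∀ x, 0 < θ₀ x) → ∃ σ₀ : ℝ, 0 < σ₀ ∧ ∀ σ, 0 < σ → σ < σ₀ → ∀ T, 0 < T → ∀ Φ : (N : ℕ) →
    HardSphereFlow (Torus.geometry (Fin 3)) (hsDiameter σ N) (N+1), ∃ K₀, 0 ≤ K₀ ∧ ∃ c, 0 < c ∧ ∃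
    N₀, ∀ N, N₀ ≤ N → ∀ s t, 0 ≤ s → s ≤ t → t ≤ T → ENNReal.ofReal (c*(σ^2*((N+1 : ℕ) : ℝ)^((1 :
    ℝ)/3)))*∫⁻ τ in Ioc s t, (∫⁻ z, ENNReal.ofReal (((N+1 : ℕ) : ℝ)⁻¹*∑ i, if K₀ < ‖((Φ N).flow τ z
    i).2‖ then ‖((Φ N).flow τ z i).2‖^5 else 0) ∂localGibbsLaw σ a₀ u₀ θ₀ N (Φ N)) ≤ ∫⁻ z, (∑ᶠ τ ∈
    collisionTimes (Torus.geometry (Fin 3)) (hsDiameter σ N) ((Φ N).flow · z) ∩ Ioc s t, ∑ i, ∑ j,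
    if i = j then 0 else (contactSet (Torus.geometry (Fin 3)) _ (hsDiameter σ N) i j).indicator (fun
    y => if K₀ < ‖(collidePair (Torus.geometry (Fin 3)) i j y i).2‖ then ENNReal.ofReal (((N+1 : ℕ)
    : ℝ)⁻¹*‖(collidePair (Torus.geometry (Fin 3)) i j y i).2‖^4) else 0) ((Φ N).flow τ z))
    ∂localGibbsLaw σ a₀ u₀ θ₀ N (Φ N)) → (∀ (a₀ θ₀ : T3 → ℝ) (u₀ : T3 → V3), Continuous a₀ →
    Continuous θ₀ → Continuous u₀ → (∀ x, 0 < a₀ x) → (∀ x, 0 < θ₀ x) → ∃ σ₀ : ℝ, 0 < σ₀ ∧ ∀ σ, 0 <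
    σ → σ < σ₀ → ∀ T, 0 < T → ∀ Φ : (N : ℕ) → HardSphereFlow (Torus.geometry (Fin 3)) (hsDiameter σ
    N) (N+1), ∃ δ, 0 < δ ∧ ∃ N₀, ∀ N, N₀ ≤ N → ∀ s t, 0 ≤ s → s ≤ t → t ≤ T → ENNReal.ofReal δ*(∫⁻
    z, (∑ᶠ τ ∈ collisionTimes (Torus.geometry (Fin 3)) (hsDiameter σ N) ((Φ N).flow · z) ∩ Ioc s t,
    ∑ i, ∑ j, if i = j then 0 else (contactSet (Torus.geometry (Fin 3)) _ (hsDiameter σ N) i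
    j).indicator (fun y => ENNReal.ofReal (((N+1 : ℕ) : ℝ)⁻¹*(‖(y i).2‖^2 + ‖(y j).2‖^2)^2)) ((Φ
    N).flow τ z)) ∂localGibbsLaw σ a₀ u₀ θ₀ N (Φ N)) ≤ (∫⁻ z, (∑ᶠ τ ∈ collisionTimes (Torus.geometry
    (Fin 3)) (hsDiameter σ N) ((Φ N).flow · z) ∩ Ioc s t, ∑ i, ∑ j, if i = j then 0 else (contactSet
    (Torus.geometry (Fin 3)) _ (hsDiameter σ N) i j).indicator (fun y => ENNReal.ofReal (((N+1 : ℕ)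
    : ℝ)⁻¹*(2*(‖(y i).2‖^2*‖(y j).2‖^2)))) ((Φ N).flow τ z)) ∂localGibbsLaw σ a₀ u₀ θ₀ N (Φ N))) →
    (∀ (a₀ θ₀ : T3 → ℝ) (u₀ : T3 → V3), Continuous a₀ → Continuous θ₀ → Continuous u₀ → (∀ x, 0 < a₀
    x) → (∀ x, 0 < θ₀ x) → ∃ σ₀ : ℝ, 0 < σ₀ ∧ ∀ σ, 0 < σ → σ < σ₀ → ∀ T, 0 < T → ∀ Φ : (N : ℕ) →
    HardSphereFlow (Torus.geometry (Fin 3)) (hsDiameter σ N) (N+1), ∃ C, 0 ≤ C ∧ ∃ N₀, ∀ N : ℕ, N₀ ≤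
    N → ∀ s s', 0 ≤ s → s ≤ s' → s' ≤ T → (∫⁻ z, ENNReal.ofReal (((N : ℝ)+1)⁻¹*(Φ N).collisionSum
    (Ioc s s') (fun col => ‖col.preVel.1‖^2*‖col.preVel.2‖^2) z) ∂localGibbsLaw σ a₀ u₀ θ₀ N (Φ N))
    ≤ ENNReal.ofReal (C*(σ^2*((N : ℝ)+1)^(1/3 : ℝ)*(s' - s)))*(⨆ r ∈ Icc s s', (∫⁻ z, ENNReal.ofReal
    (((N : ℝ)+1)⁻¹*∑ i, ‖((Φ N).flow r z i).2‖^2) ∂localGibbsLaw σ a₀ u₀ θ₀ N (Φ N)))*(⨆ r ∈ Icc s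
    s', (∫⁻ z, ENNReal.ofReal (((N : ℝ)+1)⁻¹*∑ i, ‖((Φ N).flow r z i).2‖^3) ∂localGibbsLaw σ a₀ u₀
    θ₀ N (Φ N)))) → ∀ (a₀ θ₀ : T3 → ℝ) (u₀ : T3 → V3), Continuous a₀ → Continuous θ₀ → Continuous u₀
    → (∀ x, 0 < a₀ x) → (∀ x, 0 < θ₀ x) → ∃ σ₀ : ℝ, 0 < σ₀ ∧ ∀ σ, 0 < σ → σ < σ₀ → ∀ T, 0 < T → ∀ Φ
    : (N : ℕ) → HardSphereFlow (Torus.geometry (Fin 3)) (hsDiameter σ N) (N+1), ∃ δ, 0 < δ ∧ ∃ K₀, 1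
    ≤ K₀ ∧ ∃ C, 0 ≤ C ∧ ∃ N₀, ∀ N : ℕ, N₀ ≤ N → ∀ s s', 0 ≤ s → s ≤ s' → s' ≤ T → ENNReal.ofReal
    (δ*(σ^2*((N : ℝ)+1)^(1/3 : ℝ)))*(∫⁻ r in Ioc s s', (∫⁻ z, ENNReal.ofReal (((N : ℝ)+1)⁻¹*∑ i, (if
    K₀ < ‖((Φ N).flow r z i).2‖ then ‖((Φ N).flow r z i).2‖^5 else 0)) ∂localGibbsLaw σ a₀ u₀ θ₀ N
    (Φ N))) ≤ (∫⁻ z, ENNReal.ofReal (((N : ℝ)+1)⁻¹*(Φ N).collisionSum (Ioc s s') (fun col => max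
    (‖col.preVel.1‖^4 + ‖col.preVel.2‖^4 - ‖col.postVel.1‖^4 - ‖col.postVel.2‖^4) 0 / 2) z)
    ∂localGibbsLaw σ a₀ u₀ θ₀ N (Φ N)) + ENNReal.ofReal (C*(σ^2*((N : ℝ)+1)^(1/3 : ℝ)*(s' - s)))*(⨆
    r ∈ Icc s s', (∫⁻ z, ENNReal.ofReal (((N : ℝ)+1)⁻¹*∑ i, ‖((Φ N).flow r z i).2‖^2) ∂localGibbsLaw
    σ a₀ u₀ θ₀ N (Φ N)))*(⨆ r ∈ Icc s s', (∫⁻ z, ENNReal.ofReal (((N : ℝ)+1)⁻¹*∑ i, ‖((Φ N).flow r z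
    i).2‖^3) ∂localGibbsLaw σ a₀ u₀ θ₀ N (Φ N))) := by
  intro hRF hSD hFX a₀ θ₀ u₀ ha hθ hu ha0 hθ0
  obtain ⟨σ₁, hσ₁, H1⟩ := hRF a₀ θ₀ u₀ ha hθ hu ha0 hθ0
  obtain ⟨σ₂, hσ₂, H2⟩ := hSD a₀ θ₀ u₀ ha hθ hu ha0 hθ0
  obtain ⟨σ₃, hσ₃, H3⟩ := hFX a₀ θ₀ u₀ ha hθ hu ha0 hθ0
  refine ⟨min (min σ₁ σ₂) (min σ₃ (1 / 2)), by positivity, ?_⟩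
  intro σ hσ hσ0 T hT Φ
  obtain ⟨⟨hσ₁', hσ₂'⟩, hσ₃', hσh⟩ : (σ < σ₁ ∧ σ < σ₂) ∧ σ < σ₃ ∧ σ < 1 / 2 := by
    simpa only [lt_min_iff] using hσ0
  obtain ⟨K₀, -, c, hc, N₁, HR⟩ := H1 σ hσ hσ₁' T hT Φ
  obtain ⟨δ, hδ, N₂, HS⟩ := H2 σ hσ hσ₂' T hT Φ
  obtain ⟨C, hC, N₃, HF⟩ := H3 σ hσ hσ₃' T hT Φ
  refine ⟨δ * c / 2, by positivity, max K₀ 1, le_max_right _ _, C, hC, max N₁ (max N₂ N₃), ?_⟩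
  intro N hN s s' hs hss' hs'T
  have key₁ := HR N ((le_max_left _ _).trans hN) s s' hs hss' hs'T
  have key₂ := HS N (((le_max_left _ _).trans (le_max_right _ _)).trans hN) s s' hs hss' hs'T
  have key₃ := HF N (((le_max_right _ _).trans (le_max_right _ _)).trans hN) s s' hs hss' hs'T
  have hcast : ((N + 1 : ℕ) : ℝ) = (N : ℝ) + 1 := by push_cast; ring
  rw [hcast] at key₁ key₂
  set μ : Measure (Config (N + 1) (Fin 3) T3) := localGibbsLaw σ a₀ u₀ θ₀ N (Φ N)
  have hgood : ∀ᵐ z ∂μ, z ∈ (Φ N).good := ae_mem_good_localGibbsLaw σ a₀ u₀ θ₀ N (Φ N)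
  have hε : hsDiameter σ N < 2⁻¹ := (hsDiameter_le hσ.le N).trans_lt (by rw [inv_eq_one_div]; exact hσh)
  have hc' : (0 : ℝ) ≤ ((N : ℝ) + 1)⁻¹ := by positivity
  -- (1) raising the cut-off from `K₀` to `max K₀ 1`
  have h5 : (∫⁻ r in Set.Ioc s s', (∫⁻ z, ENNReal.ofReal (((N : ℝ) + 1)⁻¹ *
        ∑ i : Fin (N + 1), (if max K₀ 1 < ‖((Φ N).flow r z i).2‖ then
          ‖((Φ N).flow r z i).2‖ ^ 5 else 0)) ∂μ)) ≤
      ∫⁻ τ in Set.Ioc s s', (∫⁻ z, ENNReal.ofReal (((N : ℝ) + 1)⁻¹ *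
        ∑ i : Fin (N + 1), if K₀ < ‖(((Φ N).flow τ z) i).2‖ then
          ‖(((Φ N).flow τ z) i).2‖ ^ 5 else 0) ∂μ) :=
    lintegral_mono fun r => lintegral_mono fun z => ENNReal.ofReal_le_ofReal
      (mul_le_mul_of_nonneg_left (Finset.sum_le_sum fun i _ =>
        c5lif_cutoff_mono (le_max_left K₀ 1) (norm_nonneg _)) hc')
  -- (2) RF₂ in collision-sum form (bridge on the good set, pre-collisional marks)
  have hP : ENNReal.ofReal (c * (σ ^ 2 * ((N : ℝ) + 1) ^ ((1 : ℝ) / 3))) *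
      (∫⁻ τ in Set.Ioc s s', (∫⁻ z, ENNReal.ofReal (((N : ℝ) + 1)⁻¹ *
        ∑ i : Fin (N + 1), if K₀ < ‖(((Φ N).flow τ z) i).2‖ then
          ‖(((Φ N).flow τ z) i).2‖ ^ 5 else 0) ∂μ)) ≤
      ∫⁻ z, ENNReal.ofReal ((Φ N).collisionSum (Set.Ioc s s')
        (fun col => if K₀ < ‖col.preVel.1‖ then ((N : ℝ) + 1)⁻¹ * ‖col.preVel.1‖ ^ 4 else 0) z)
        ∂μ := by
    refine key₁.trans_eq (lintegral_congr_ae ?_)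
    filter_upwards [hgood] with z hz
    exact c5lif_bridge_cutoff (Φ N) hz s s' K₀ _ hc'
  -- (3) `𝟙‖v₁⁻‖⁴ ≤ E²` record by record
  have hPQ : (∫⁻ z, ENNReal.ofReal ((Φ N).collisionSum (Set.Ioc s s')
        (fun col => if K₀ < ‖col.preVel.1‖ then ((N : ℝ) + 1)⁻¹ * ‖col.preVel.1‖ ^ 4 else 0) z)
        ∂μ) ≤
      ∫⁻ z, ENNReal.ofReal ((Φ N).collisionSum (Set.Ioc s s')
        (fun col => ((N : ℝ) + 1)⁻¹ * (‖col.postVel.1‖ ^ 2 + ‖col.postVel.2‖ ^ 2) ^ 2) z) ∂μ := by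
    refine lintegral_mono_ae ?_
    filter_upwards [hgood] with z hz
    exact ENNReal.ofReal_le_ofReal (c5lif_cutoffSum_le_sqESum (Φ N) hz s s' K₀ hc')
  -- (4) SD in collision-sum form (bridge on the good set, post-collisional marks)
  have hQR : ENNReal.ofReal δ * (∫⁻ z, ENNReal.ofReal ((Φ N).collisionSum (Set.Ioc s s')
        (fun col => ((N : ℝ) + 1)⁻¹ * (‖col.postVel.1‖ ^ 2 + ‖col.postVel.2‖ ^ 2) ^ 2) z) ∂μ) ≤
      ∫⁻ z, ENNReal.ofReal ((Φ N).collisionSum (Set.Ioc s s')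
        (fun col => ((N : ℝ) + 1)⁻¹ * (2 * (‖col.postVel.1‖ ^ 2 * ‖col.postVel.2‖ ^ 2))) z)
        ∂μ := by
    refine Eq.trans_le ?_ (key₂.trans_eq (lintegral_congr_ae ?_))
    · refine congrArg (fun x => ENNReal.ofReal δ * x) (lintegral_congr_ae ?_)
      filter_upwards [hgood] with z hz
      exact (c5lif_bridge_post (Φ N) hz s s'
        (fun v w => ((N : ℝ) + 1)⁻¹ * (‖v‖ ^ 2 + ‖w‖ ^ 2) ^ 2) fun v w => by positivity).symm
    · filter_upwards [hgood] with z hz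
      exact c5lif_bridge_post (Φ N) hz s s'
        (fun v w => ((N : ℝ) + 1)⁻¹ * (2 * (‖v‖ ^ 2 * ‖w‖ ^ 2))) fun v w => by positivity
  -- (5) `2mix⁺ ≤ 2(Δ₄)₋/2 + 2mix⁻` record by record, integrated (the flux integrand is a.e.-measurable)
  have hR : (∫⁻ z, ENNReal.ofReal ((Φ N).collisionSum (Set.Ioc s s')
        (fun col => ((N : ℝ) + 1)⁻¹ * (2 * (‖col.postVel.1‖ ^ 2 * ‖col.postVel.2‖ ^ 2))) z)
        ∂μ) ≤
      2 * (∫⁻ z, ENNReal.ofReal (((N : ℝ) + 1)⁻¹ *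
          (Φ N).collisionSum (Set.Ioc s s')
            (fun col => max (‖col.preVel.1‖ ^ 4 + ‖col.preVel.2‖ ^ 4
              - ‖col.postVel.1‖ ^ 4 - ‖col.postVel.2‖ ^ 4) 0 / 2) z) ∂μ) +
      2 * (∫⁻ z, ENNReal.ofReal (((N : ℝ) + 1)⁻¹ *
          (Φ N).collisionSum (Set.Ioc s s')
            (fun col => ‖col.preVel.1‖ ^ 2 * ‖col.preVel.2‖ ^ 2) z) ∂μ) := by
    rw [← lintegral_const_mul' _ _ (ENNReal.ofNat_ne_top : (2 : ℝ≥0∞) ≠ ∞),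
      ← lintegral_const_mul' _ _ (ENNReal.ofNat_ne_top : (2 : ℝ≥0∞) ≠ ∞),
      ← lintegral_add_right' _
        ((((c5lif_aemeasurable_fluxSum hε (Φ N) s s' hgood).const_mul _).ennreal_ofReal).const_mul _)]
    refine lintegral_mono_ae ?_
    filter_upwards [hgood] with z hz
    exact c5lif_ofReal_mixpostSum_le (Φ N) hz s s' hc'
  -- (6) assemble with S2a″
  exact c5lif_assembly hδ.le h5 hP hPQ hQR hR key₃

end Summit.AtomisticToContinuum.HydrodynamicLimit.Theorems.QuarticSchurLedger

end
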